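import Literature.AlgebraicGeometry.Resolution.ArithmeticalThreefoldsLocalRankReductionEmbedded
import Literature.AlgebraicGeometry.Resolution.ExcellentRingsCompleteHolds
import Literature.AlgebraicGeometry.Resolution.LocalBlowup
import Literature.RingTheory.CompleteLocalRings.CohenRegularPresentation
import HarnessLib

/-!
# (LU) for complete Noetherian local domains of dimension ≤ 2, from Cossart–Jannsen–Saito Thm. 1.4

Topic: `Literature/AlgebraicGeometry/Resolution` (proofs only; no new notions, no new named
facts). Cossart–Piltant's property (LU) (`CPLocalUniformization`, CP 2019 §4.1) for every
complete Noetherian local DOMAIN of Krull dimension `≤ 2`, from the EMBEDDED resolution theorem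
of Cossart–Jannsen–Saito (LNM 2270, Thm. 1.4 with `B = ∅`; the tree's named fact
`CossartJannsenSaito2020Embedded`, stub 1 of the `CleanModels` crux):

* `cpLocalUniformization_of_isAdicComplete_of_ringKrullDim_le_two`.

Proof: by the Cohen structure theorem (Matsumura Thm. 29.4 (ii), the tree's
`exists_isRegularLocalRing_surjective_of_isAdicComplete`) `A` is a quotient of a complete — hence
excellent — regular local ring `S`; `A = im(S → K) ⊆ O` is the bottom `S`-model of `K = Frac A`,
its local ring at the centre of `O` is `A` itself (domination), of dimension `≤ 2`; the tree's
`exists_model_regular_of_cjsEmbedded` (CJS Thm. 1.4 for `Spec A ↪ Spec S[Y][X]_𝔫`, valuative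
criterion) returns a finitely generated `S`-model `A₁ ⊇ A` inside `O` regular at the centre,
and `A₁ = A[t]`.

Use: the residual local uniformizations on the quotients `Â/P∞` of dimension `≤ 2` in the
composite route to Cossart–Piltant 2019 Prop. 4.8 (`ArithmeticalThreefoldsDescentHeadQuotientLU.lean`).

## Sources

* V. Cossart, U. Jannsen, S. Saito, LNM 2270 (2020), Thm. 1.4, Cor. 1.5. [CossartJannsenSaito2020]
* H. Matsumura, *Commutative Ring Theory* (1986), Thm. 29.4 (ii). [Matsumura1987]
* V. Cossart, O. Piltant, J. Algebra 529 (2019), §4.1 (LU). [CossartPiltant2019]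
-/

noncomputable section

namespace Literature.AlgebraicGeometry.Resolution

universe u

open IsLocalRing Function

set_option maxHeartbeats 1600000 in
/-- **(LU) for complete Noetherian local domains of dimension `≤ 2`** from Cossart–Jannsen–Saito
Thm. 1.4 (`B = ∅`): for every complete Noetherian local domain `A` with `dim A ≤ 2`, every
valuation ring `O` of `Frac A` containing and dominating `A` (with residues algebraic over `A`,
unused) is uniformized by a finitely generated `A[t] ⊆ O`, regular at the centre of `O`. Cohen
presentation `S ↠ A` with `S` complete regular local (excellent), then
`exists_model_regular_of_cjsEmbedded` for the bottom `S`-model `A ⊆ O` of `Frac A`.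
[cite: CossartJannsenSaito2020, Thm. 1.4 (pp. 5–6)] [cite: Matsumura1987, Thm. 29.4 (ii)]
[cite: CossartPiltant2019, §4.1 (LU)] -/
theorem cpLocalUniformization_of_isAdicComplete_of_ringKrullDim_le_two
    (hCJSE : CossartJannsenSaito2020Embedded.{u})
    (A : Type u) [CommRing A] [IsDomain A] [IsLocalRing A] [IsNoetherianRing A]
    [IsAdicComplete (maximalIdeal A) A] (hdim : ringKrullDim A ≤ 2) :
    CPLocalUniformization A := by
  intro K _ _ _ O hAO hdom _halg
  classical
  -- Cohen presentation `f : S ↠ A`, `S` complete regular local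
  obtain ⟨S, _, _, hSc, f, hf⟩ :=
    Literature.RingTheory.CompleteLocalRings.exists_isRegularLocalRing_surjective_of_isAdicComplete A
  haveI := hSc
  haveI : IsRegularRing S := isRegularRing_of_isRegularLocalRing S
  haveI : IsDomain S := isDomain_of_isRegularLocalRing S
  have hS : IsExcellentRing S := isExcellentRing_of_isAdicComplete S
  letI : Algebra S K := ((algebraMap A K).comp f).toAlgebra
  have halgS : ∀ s : S, algebraMap S K s = algebraMap A K (f s) := fun _ => rfl
  have hinjA : Function.Injective (algebraMap A K) := IsFractionRing.injective A K
  -- the bottom model `R = im S = im A`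
  set R : Subalgebra S K := ⊥ with hRdef
  have hmemR : ∀ x : K, x ∈ R ↔ ∃ a : A, algebraMap A K a = x := by
    intro x
    rw [hRdef, Algebra.mem_bot, Set.mem_range]
    constructor
    · rintro ⟨s, rfl⟩; exact ⟨f s, (halgS s).symm⟩
    · rintro ⟨a, rfl⟩
      obtain ⟨s, rfl⟩ := hf a
      exact ⟨s, halgS s⟩
  have hAR : ∀ a : A, algebraMap A K a ∈ R := fun a => (hmemR _).mpr ⟨a, rfl⟩
  -- `e : A ≃+* R`
  let g : A →+* R := (algebraMap A K).codRestrict R.toSubring hAR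
  have hgval : ∀ a : A, ((g a : R) : K) = algebraMap A K a := fun _ => rfl
  have hgbij : Function.Bijective g := by
    refine ⟨fun a b hab => hinjA (by rw [← hgval a, ← hgval b, hab]), fun z => ?_⟩
    obtain ⟨a, ha⟩ := (hmemR _).mp z.2
    exact ⟨a, Subtype.ext ha⟩
  let e : A ≃+* R := RingEquiv.ofBijective g hgbij
  haveI : IsNoetherianRing R := isNoetherianRing_of_ringEquiv A e
  haveI hRloc : IsLocalRing R := e.isLocalRing
  have hRfg : R.FG := Subalgebra.fg_bot
  haveI : FaithfulSMul R K := (faithfulSMul_iff_algebraMap_injective R K).mpr Subtype.val_injective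
  haveI : IsFractionRing R K := by
    refine IsFractionRing.of_field (R := R) (K := K) fun z => ?_
    obtain ⟨a, b, -, rfl⟩ := IsFractionRing.div_surjective (A := A) z
    exact ⟨g a, g b, rfl⟩
  have hRO : R.toSubring ≤ O.toSubring := by
    intro x hx
    obtain ⟨a, rfl⟩ := (hmemR x).mp hx
    exact hAO a
  -- the centre `P'` of `O` on `R`
  let ρ : R →+* O := (R.val : R →+* K).codRestrict O.toSubring fun z => hRO z.2
  set P' : Ideal R := (maximalIdeal O).comap ρ with hP'def
  haveI : P'.IsPrime := Ideal.IsPrime.comap ρ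
  have hP' : ∀ z : R, z ∈ P' ↔ O.valuation (z : K) < 1 := fun z => by
    rw [hP'def, Ideal.mem_comap, ValuationSubring.valuation_lt_one_iff]; rfl
  -- elements of `R` off the centre are units (`O` dominates `A`)
  have hunit : ∀ z : R, z ∉ P' → IsUnit z := by
    intro z hz
    obtain ⟨a, ha⟩ := hgbij.2 z
    have hau : IsUnit a := by
      by_contra hna
      apply hz
      rw [hP', ← ha, hgval]
      exact hdom a ((IsLocalRing.mem_maximalIdeal a).mpr (mem_nonunits_iff.mpr hna))
    rw [← ha]; exact hau.map g
  have hdimP : ringKrullDim (Localization.AtPrime P') ≤ 2 := by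
    let eL : R ≃ₐ[R] Localization.AtPrime P' :=
      IsLocalization.atUnits R P'.primeCompl fun z hz => hunit z hz
    rw [← ringKrullDim_eq_of_ringEquiv eL.toRingEquiv, ← ringKrullDim_eq_of_ringEquiv e]
    exact hdim
  -- CJS Thm. 1.4 over the regular excellent base `S`
  obtain ⟨A₁, hA₁, -, hA₁fg, hreg⟩ :=
    exists_model_regular_of_cjsEmbedded hCJSE hS O R hRfg hRO P' hP' hdimP
  obtain ⟨t, ht⟩ := hA₁fg
  -- `A₁ = S[t] = A[t]`
  have hrange : Set.range (algebraMap S K) = Set.range (algebraMap A K) := by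
    ext x
    constructor
    · rintro ⟨s, rfl⟩; exact ⟨f s, (halgS s).symm⟩
    · rintro ⟨a, rfl⟩
      obtain ⟨s, rfl⟩ := hf a
      exact ⟨s, halgS s⟩
  have heq : (Algebra.adjoin A (t : Set K)).toSubring = A₁.toSubring := by
    rw [← ht, Algebra.adjoin_eq_ring_closure, Algebra.adjoin_eq_ring_closure, hrange]
  have h : (Algebra.adjoin A (t : Set K)).toSubring ≤ O.toSubring := by rw [heq]; exact hA₁
  refine ⟨t, h, ?_⟩
  have h1 := (isRegularLocalRing_locAtCentre_iff hA₁).mpr hreg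
  have h2 : locAtCentre (Algebra.adjoin A (t : Set K)).toSubring O = locAtCentre A₁.toSubring O := by
    rw [heq]
  rw [← h2] at h1
  exact (isRegularLocalRing_locAtCentre_iff h).mp h1

end Literature.AlgebraicGeometry.Resolution

end
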